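import Mathlib
import Summits.NavierStokesRegularity.NavierStokesRegularity.Theorems.WakeRatchetTailRatchetRelayDilationLipschitz
import HarnessLib

/-!
# `WakeRatchet.TailRatchet` (stmt-NavierStokesRegularity-21808): LIPSCHITZ DEPENDENCE OF THE FRONT FORCING
# ON THE TIME RATIO `s` — quadratic and drain terms, assembled bound

Support file for the crux `TailRatchet` (route `WakeRatchet`; MODEL lattice ODEs of Tao 2016 §1.2, §4 —
nothing in this file is a statement about the Navier–Stokes equations, and no item is closed here).

Continuation of `…RelayDilationLipschitz` (census of stmt-21808, programme R-lac → continuation in `s`):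
for `3/2 ≤ s₁, s₂ ≤ σ < 2` and a state `|h|, |h'| ≤ r e^{ξ/2}`, `|δ| ≤ r`,

* `spare_decay` — `|t|·e^{(1/σ − 1/2)t} ≤ 2/(2−σ)`: the decay to spare below `s = 2` absorbs the factor `|t|`
  produced by differentiating a dilation;
* `quadratic_piece_one`, `quadratic_piece_two`, `quadratic_lipschitz_s` — the quadratic term
  (`≤ (4r² + 4r²/(2−σ))|s₁−s₂|e^{t/2}`; critical at `σ = 2`);
* `drain_lipschitz_s` — the drain term (`≤ 3(1+r)²|s₁−s₂|e^{t/2}` before the factor `4|δ|`);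
* `forcing_lipschitz_s` — `|N_{s₁}(h,δ)(t) − N_{s₂}(h,δ)(t)| ≤ (6 + 16r + 4r² + 4r²·(1/(2−σ)) + 12r(1+r)²)·|s₁−s₂|·e^{t/2}`.

HONEST FRAMING: elementary inequalities; MODEL lattice only; lacunary fronts (LARGE `ε₀`) do NOT refute
`TailRatchet` (which needs `Λ → 1`); the construction item and the crux stay open.
-/

noncomputable section

set_option linter.dupNamespace false

namespace Summit.NavierStokesRegularity.NavierStokesRegularity.Theorems

namespace WakeRatchetRelayDilationLipschitz

open Set Filter Topology
open WakeRatchetRelayFrozenDilation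

/-! ## The quadratic term (needs `s ≤ σ < 2`) -/

/-- Spare decay absorbs `|t|`: `|t|·e^{(1/σ − 1/2)t} ≤ 2/(2−σ)` for `0 < σ < 2`, `t ≤ 0`. [folklore] -/
theorem spare_decay {σ t : ℝ} (hσ0 : 0 < σ) (hσ : σ < 2) (ht : t ≤ 0) :
    |t| * Real.exp ((1 / σ - 1 / 2) * t) ≤ 2 * (1 / (2 - σ)) := by
  have h2σ : 0 < 2 - σ := by linarith
  have hu : 1 / σ * σ = 1 := one_div_mul_cancel hσ0.ne'
  have hθ' : (2 - σ) / 4 ≤ 1 / σ - 1 / 2 := by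
    rw [div_le_iff₀ (by norm_num : (0 : ℝ) < 4)]
    nlinarith [sq_nonneg (2 * (1 / σ) - 1), mul_pos hσ0 (one_div_pos.2 hσ0), hu]
  have hc : 0 < (2 - σ) / 4 := by positivity
  have h1 : Real.exp ((1 / σ - 1 / 2) * t) ≤ Real.exp ((2 - σ) / 4 * t) :=
    Real.exp_le_exp.2 (by nlinarith)
  have h2 : |t| * Real.exp ((2 - σ) / 4 * t) ≤ 1 / (2 * ((2 - σ) / 4)) := abs_mul_exp_mul_le hc ht
  have h3 : 1 / (2 * ((2 - σ) / 4)) = 2 * (1 / (2 - σ)) := by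
    rw [show 2 * ((2 - σ) / 4) = (2 - σ) / 2 by ring, one_div_div]; ring
  have h4 : |t| * Real.exp ((1 / σ - 1 / 2) * t) ≤ |t| * Real.exp ((2 - σ) / 4 * t) :=
    mul_le_mul_of_nonneg_left h1 (abs_nonneg _)
  linarith

/-- First piece of the quadratic term: `|4(1/s₁² − 1/s₂²)h(t/s₁)²| ≤ 4r²|s₁−s₂|e^{t/2}`. [folklore] -/
theorem quadratic_piece_one {s₁ s₂ r : ℝ} (h₁ : 3 / 2 ≤ s₁) (h₁' : s₁ ≤ 2) (h₂ : 3 / 2 ≤ s₂)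
    (h₂' : s₂ ≤ 2) {h : ℝ → ℝ}
    (hρ : ∀ ξ : ℝ, ξ ≤ 0 → |h ξ| ≤ r * Real.exp (ξ / 2)) {t : ℝ} (ht : t < 0) :
    |4 * (1 / s₁ ^ 2 - 1 / s₂ ^ 2) * h (t / s₁) ^ 2| ≤ 4 * r ^ 2 * |s₁ - s₂| * Real.exp (t / 2) := by
  have hs₁ : 0 < s₁ := by linarith
  have ha0 : t / s₁ ≤ 0 := div_nonpos_of_nonpos_of_nonneg ht.le hs₁.le
  rw [abs_mul, abs_mul, abs_of_pos (by norm_num : (0 : ℝ) < 4), abs_pow]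
  have h1 := inv_sq_sub_inv_sq_abs_le h₁ h₁' h₂ h₂'
  have hq : |h (t / s₁)| ^ 2 ≤ r ^ 2 * Real.exp (t / 2) := by
    have hx : |h (t / s₁)| ≤ r * Real.exp (t / s₁ / 2) := hρ _ ha0
    have hy : Real.exp (t / s₁ / 2) * Real.exp (t / s₁ / 2) = Real.exp (t / s₁) := by
      rw [← Real.exp_add]; ring_nf
    have hz : Real.exp (t / s₁) ≤ Real.exp (t / 2) :=
      Real.exp_le_exp.2 (by rw [div_le_div_iff₀ hs₁ (by norm_num)]; nlinarith)
    calc |h (t / s₁)| ^ 2 ≤ (r * Real.exp (t / s₁ / 2)) ^ 2 := pow_le_pow_left₀ (abs_nonneg _) hx 2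
      _ = r ^ 2 * Real.exp (t / s₁) := by rw [mul_pow, sq (Real.exp _), hy]
      _ ≤ r ^ 2 * Real.exp (t / 2) := mul_le_mul_of_nonneg_left hz (sq_nonneg r)
  calc 4 * |1 / s₁ ^ 2 - 1 / s₂ ^ 2| * |h (t / s₁)| ^ 2 ≤ 4 * |s₁ - s₂| * (r ^ 2 * Real.exp (t / 2)) :=
      mul_le_mul (mul_le_mul_of_nonneg_left h1 (by norm_num)) hq (by positivity) (by positivity)
    _ = 4 * r ^ 2 * |s₁ - s₂| * Real.exp (t / 2) := by ring

/-- Second piece of the quadratic term: `|(4/s₂²)(h(t/s₁) − h(t/s₂))(h(t/s₁) + h(t/s₂))| ≤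
4r²·(1/(2−σ))·|s₁−s₂|e^{t/2}` for `3/2 ≤ sᵢ ≤ σ < 2`. [folklore] -/
theorem quadratic_piece_two {s₁ s₂ σ r : ℝ} (h₁ : 3 / 2 ≤ s₁) (h₁' : s₁ ≤ σ) (h₂ : 3 / 2 ≤ s₂)
    (h₂' : s₂ ≤ σ) (hσ : σ < 2) {h h' : ℝ → ℝ}
    (hd : ∀ ξ : ℝ, ξ < 0 → HasDerivAt h (h' ξ) ξ)
    (hρ : ∀ ξ : ℝ, ξ ≤ 0 → |h ξ| ≤ r * Real.exp (ξ / 2))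
    (hD : ∀ ξ : ℝ, ξ < 0 → |h' ξ| ≤ r * Real.exp (ξ / 2)) {t : ℝ} (ht : t < 0) :
    |4 / s₂ ^ 2 * ((h (t / s₁) - h (t / s₂)) * (h (t / s₁) + h (t / s₂)))| ≤
      4 * r ^ 2 * (1 / (2 - σ)) * |s₁ - s₂| * Real.exp (t / 2) := by
  have hs₁ : 0 < s₁ := by linarith
  have hs₂ : 0 < s₂ := by linarith
  have hσ0 : 0 < σ := by linarith
  have hr0 : 0 ≤ r := by
    have := hρ 0 le_rfl; rw [zero_div, Real.exp_zero, mul_one] at this; exact (abs_nonneg _).trans this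
  set Δ := |s₁ - s₂| with hΔ
  have hΔ0 : 0 ≤ Δ := abs_nonneg _
  have e2 : 0 < Real.exp (t / 2) := Real.exp_pos _
  have hq0 : 0 < 1 / (2 - σ) := one_div_pos.2 (by linarith)
  -- dilated points lie below `M = t/σ < 0`
  have hM : t / σ < 0 := div_neg_of_neg_of_pos ht hσ0
  have ha : t / s₁ ≤ t / σ := by rw [div_le_div_iff₀ hs₁ hσ0]; nlinarith
  have hb : t / s₂ ≤ t / σ := by rw [div_le_div_iff₀ hs₂ hσ0]; nlinarith
  have ha0 : t / s₁ ≤ 0 := by linarith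
  have hb0 : t / s₂ ≤ 0 := by linarith
  have hab : |t / s₁ - t / s₂| ≤ 4 / 9 * |t| * Δ := by
    have : t / s₁ - t / s₂ = t * (1 / s₁ - 1 / s₂) := by ring
    rw [this, abs_mul]
    have h1 := inv_sub_inv_abs_le h₁ h₂
    calc |t| * |1 / s₁ - 1 / s₂| ≤ |t| * (4 / 9 * |s₁ - s₂|) :=
        mul_le_mul_of_nonneg_left h1 (abs_nonneg _)
      _ = 4 / 9 * |t| * Δ := by ring
  -- `|h(t/sᵢ)| ≤ r e^{t/(2σ)}`
  have hw : ∀ {x : ℝ}, x ≤ t / σ → x ≤ 0 → |h x| ≤ r * Real.exp (t / σ / 2) := fun hx hx0 =>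
    (hρ _ hx0).trans (mul_le_mul_of_nonneg_left (Real.exp_le_exp.2 (by linarith)) hr0)
  have hh₁ := hw ha ha0
  have hh₂ := hw hb hb0
  have h49 : 4 / s₂ ^ 2 ≤ (16 : ℝ) / 9 := by
    rw [div_le_div_iff₀ (by positivity) (by norm_num)]; nlinarith
  have hmv := sub_abs_le_of_deriv hd hD hM ha hb
  have hdiff : |h (t / s₁) - h (t / s₂)| ≤ r * Real.exp (t / σ / 2) * (4 / 9 * |t| * Δ) :=
    hmv.trans (mul_le_mul_of_nonneg_left hab (by positivity))
  have hsum : |h (t / s₁) + h (t / s₂)| ≤ 2 * (r * Real.exp (t / σ / 2)) :=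
    (abs_add_le _ _).trans (by linarith)
  have hee : Real.exp (t / σ / 2) * Real.exp (t / σ / 2) =
      Real.exp (t / 2) * Real.exp ((1 / σ - 1 / 2) * t) := by
    rw [← Real.exp_add, ← Real.exp_add]; ring_nf
  have hte := spare_decay hσ0 hσ ht.le
  rw [abs_mul, abs_of_pos (by positivity : (0 : ℝ) < 4 / s₂ ^ 2), abs_mul]
  have hW : 0 ≤ 128 / 81 * r ^ 2 * Δ * Real.exp (t / 2) := by positivity
  have step1 : 4 / s₂ ^ 2 * (|h (t / s₁) - h (t / s₂)| * |h (t / s₁) + h (t / s₂)|) ≤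
      16 / 9 * (r * Real.exp (t / σ / 2) * (4 / 9 * |t| * Δ) * (2 * (r * Real.exp (t / σ / 2)))) :=
    mul_le_mul h49 (mul_le_mul hdiff hsum (abs_nonneg _) (by positivity)) (by positivity) (by norm_num)
  have step2 : 16 / 9 * (r * Real.exp (t / σ / 2) * (4 / 9 * |t| * Δ) * (2 * (r * Real.exp (t / σ / 2)))) =
      128 / 81 * r ^ 2 * Δ * Real.exp (t / 2) * (|t| * Real.exp ((1 / σ - 1 / 2) * t)) := by
    have : 16 / 9 * (r * Real.exp (t / σ / 2) * (4 / 9 * |t| * Δ) * (2 * (r * Real.exp (t / σ / 2)))) =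
        128 / 81 * r ^ 2 * Δ * (Real.exp (t / σ / 2) * Real.exp (t / σ / 2)) * |t| := by ring
    rw [this, hee]; ring
  have step3 : 128 / 81 * r ^ 2 * Δ * Real.exp (t / 2) * (|t| * Real.exp ((1 / σ - 1 / 2) * t)) ≤
      128 / 81 * r ^ 2 * Δ * Real.exp (t / 2) * (2 * (1 / (2 - σ))) :=
    mul_le_mul_of_nonneg_left hte hW
  have step4 : 128 / 81 * r ^ 2 * Δ * Real.exp (t / 2) * (2 * (1 / (2 - σ))) ≤
      4 * r ^ 2 * (1 / (2 - σ)) * Δ * Real.exp (t / 2) := by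
    have h0 : 0 ≤ r ^ 2 * Δ * Real.exp (t / 2) * (1 / (2 - σ)) := by positivity
    nlinarith [h0]
  linarith [step1, step2, step3, step4]

/-- `|(4/s₁²)h(t/s₁)² − (4/s₂²)h(t/s₂)²| ≤ (4r² + 4r²·(1/(2−σ)))|s₁−s₂|e^{t/2}` for `3/2 ≤ sᵢ ≤ σ < 2`.
[folklore] -/
theorem quadratic_lipschitz_s {s₁ s₂ σ r : ℝ} (h₁ : 3 / 2 ≤ s₁) (h₁' : s₁ ≤ σ) (h₂ : 3 / 2 ≤ s₂)
    (h₂' : s₂ ≤ σ) (hσ : σ < 2) {h h' : ℝ → ℝ}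
    (hd : ∀ ξ : ℝ, ξ < 0 → HasDerivAt h (h' ξ) ξ)
    (hρ : ∀ ξ : ℝ, ξ ≤ 0 → |h ξ| ≤ r * Real.exp (ξ / 2))
    (hD : ∀ ξ : ℝ, ξ < 0 → |h' ξ| ≤ r * Real.exp (ξ / 2)) {t : ℝ} (ht : t < 0) :
    |4 / s₁ ^ 2 * h (t / s₁) ^ 2 - 4 / s₂ ^ 2 * h (t / s₂) ^ 2| ≤
      (4 * r ^ 2 + 4 * r ^ 2 * (1 / (2 - σ))) * |s₁ - s₂| * Real.exp (t / 2) := by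
  have hσ2 : σ ≤ 2 := hσ.le
  have hP1 := quadratic_piece_one h₁ (h₁'.trans hσ2) h₂ (h₂'.trans hσ2) hρ ht
  have hP2 := quadratic_piece_two h₁ h₁' h₂ h₂' hσ hd hρ hD ht
  have hsplit : 4 / s₁ ^ 2 * h (t / s₁) ^ 2 - 4 / s₂ ^ 2 * h (t / s₂) ^ 2 =
      4 * (1 / s₁ ^ 2 - 1 / s₂ ^ 2) * h (t / s₁) ^ 2 +
      4 / s₂ ^ 2 * ((h (t / s₁) - h (t / s₂)) * (h (t / s₁) + h (t / s₂))) := by ring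
  rw [hsplit]
  calc _ ≤ |4 * (1 / s₁ ^ 2 - 1 / s₂ ^ 2) * h (t / s₁) ^ 2| +
        |4 / s₂ ^ 2 * ((h (t / s₁) - h (t / s₂)) * (h (t / s₁) + h (t / s₂)))| := abs_add_le _ _
    _ ≤ 4 * r ^ 2 * |s₁ - s₂| * Real.exp (t / 2) +
        4 * r ^ 2 * (1 / (2 - σ)) * |s₁ - s₂| * Real.exp (t / 2) := add_le_add hP1 hP2
    _ = (4 * r ^ 2 + 4 * r ^ 2 * (1 / (2 - σ))) * |s₁ - s₂| * Real.exp (t / 2) := by ring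

/-! ## The drain term -/

/-- `|s₁(e^{t}+h(t))(e^{s₁t}+h(s₁t)) − s₂(e^{t}+h(t))(e^{s₂t}+h(s₂t))| ≤ 3(1+r)²|s₁−s₂|e^{t/2}` for a
state as above, `3/2 ≤ sᵢ ≤ 2`, `t < 0`. [folklore] -/
theorem drain_lipschitz_s {s₁ s₂ r : ℝ} (h₁ : 3 / 2 ≤ s₁) (h₂ : 3 / 2 ≤ s₂)
    (h₂' : s₂ ≤ 2) {h h' : ℝ → ℝ}
    (hd : ∀ ξ : ℝ, ξ < 0 → HasDerivAt h (h' ξ) ξ)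
    (hρ : ∀ ξ : ℝ, ξ ≤ 0 → |h ξ| ≤ r * Real.exp (ξ / 2))
    (hD : ∀ ξ : ℝ, ξ < 0 → |h' ξ| ≤ r * Real.exp (ξ / 2)) {t : ℝ} (ht : t < 0) :
    |s₁ * ((Real.exp t + h t) * (Real.exp (s₁ * t) + h (s₁ * t))) -
        s₂ * ((Real.exp t + h t) * (Real.exp (s₂ * t) + h (s₂ * t)))| ≤
      3 * (1 + r) ^ 2 * |s₁ - s₂| * Real.exp (t / 2) := by
  have hs₁ : 0 < s₁ := by linarith
  have hs₂ : 0 < s₂ := by linarith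
  have hr0 : 0 ≤ r := by
    have := hρ 0 le_rfl; rw [zero_div, Real.exp_zero, mul_one] at this; exact (abs_nonneg _).trans this
  set Δ := |s₁ - s₂| with hΔ
  have hΔ0 : 0 ≤ Δ := abs_nonneg _
  have e2 : 0 < Real.exp (t / 2) := Real.exp_pos _
  -- `|e^t + h(t)| ≤ (1+r)e^{t/2}`
  have hb1 : |Real.exp t + h t| ≤ (1 + r) * Real.exp (t / 2) := by
    have he : Real.exp t ≤ Real.exp (t / 2) := Real.exp_le_exp.2 (by linarith)
    calc _ ≤ |Real.exp t| + |h t| := abs_add_le _ _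
      _ ≤ Real.exp (t / 2) + r * Real.exp (t / 2) := by
          rw [abs_of_pos (Real.exp_pos _)]; linarith [hρ t ht.le]
      _ = (1 + r) * Real.exp (t / 2) := by ring
  -- the bracket `s₁(e^{s₁t}+h(s₁t)) − s₂(e^{s₂t}+h(s₂t))`
  have hM : 3 / 2 * t < 0 := by linarith
  have ha : s₁ * t ≤ 3 / 2 * t := by nlinarith
  have hb : s₂ * t ≤ 3 / 2 * t := by nlinarith
  have ha0 : s₁ * t ≤ 0 := by linarith
  have hg1 : |Real.exp (s₁ * t) + h (s₁ * t)| ≤ 1 + r := by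
    have he : Real.exp (s₁ * t) ≤ 1 := Real.exp_le_one_iff.2 ha0
    have hh : |h (s₁ * t)| ≤ r := (hρ _ ha0).trans (by
      have : Real.exp (s₁ * t / 2) ≤ 1 := Real.exp_le_one_iff.2 (by linarith); nlinarith)
    calc _ ≤ |Real.exp (s₁ * t)| + |h (s₁ * t)| := abs_add_le _ _
      _ ≤ 1 + r := by rw [abs_of_pos (Real.exp_pos _)]; linarith
  have hte1 : |t| * Real.exp (3 / 2 * t) ≤ 1 / (2 * (3 / 2)) := abs_mul_exp_mul_le (by norm_num) ht.le
  have hte2 : |t| * Real.exp (3 / 2 * t / 2) ≤ 1 / (2 * (3 / 4)) := by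
    rw [show (3 : ℝ) / 2 * t / 2 = 3 / 4 * t by ring]; exact abs_mul_exp_mul_le (by norm_num) ht.le
  have hexp : |Real.exp (s₁ * t) - Real.exp (s₂ * t)| ≤ Δ := by
    have hmv := exp_sub_exp_abs_le ha hb
    have : |s₁ * t - s₂ * t| = Δ * |t| := by rw [← sub_mul, abs_mul]
    rw [this] at hmv
    calc _ ≤ Real.exp (3 / 2 * t) * (Δ * |t|) := hmv
      _ = Δ * (|t| * Real.exp (3 / 2 * t)) := by ring
      _ ≤ Δ * (1 / (2 * (3 / 2))) := mul_le_mul_of_nonneg_left hte1 hΔ0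
      _ ≤ Δ := by nlinarith
  have hhh : |h (s₁ * t) - h (s₂ * t)| ≤ r * Δ := by
    have hmv := sub_abs_le_of_deriv hd hD hM ha hb
    have : |s₁ * t - s₂ * t| = Δ * |t| := by rw [← sub_mul, abs_mul]
    rw [this] at hmv
    calc _ ≤ r * Real.exp (3 / 2 * t / 2) * (Δ * |t|) := hmv
      _ = r * Δ * (|t| * Real.exp (3 / 2 * t / 2)) := by ring
      _ ≤ r * Δ * (1 / (2 * (3 / 4))) := mul_le_mul_of_nonneg_left hte2 (by positivity)
      _ ≤ r * Δ := by nlinarith [mul_nonneg hr0 hΔ0]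
  have hbr : |s₁ * (Real.exp (s₁ * t) + h (s₁ * t)) - s₂ * (Real.exp (s₂ * t) + h (s₂ * t))| ≤
      3 * (1 + r) * Δ := by
    have hsplit : s₁ * (Real.exp (s₁ * t) + h (s₁ * t)) - s₂ * (Real.exp (s₂ * t) + h (s₂ * t)) =
        (s₁ - s₂) * (Real.exp (s₁ * t) + h (s₁ * t)) +
        s₂ * ((Real.exp (s₁ * t) - Real.exp (s₂ * t)) + (h (s₁ * t) - h (s₂ * t))) := by ring
    rw [hsplit]
    calc _ ≤ |(s₁ - s₂) * (Real.exp (s₁ * t) + h (s₁ * t))| +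
          |s₂ * ((Real.exp (s₁ * t) - Real.exp (s₂ * t)) + (h (s₁ * t) - h (s₂ * t)))| := abs_add_le _ _
      _ ≤ Δ * (1 + r) + 2 * (Δ + r * Δ) := by
          refine add_le_add ?_ ?_
          · rw [abs_mul]; exact mul_le_mul_of_nonneg_left hg1 hΔ0
          · rw [abs_mul, abs_of_pos hs₂]
            exact mul_le_mul h₂' ((abs_add_le _ _).trans (add_le_add hexp hhh)) (abs_nonneg _) (by norm_num)
      _ = 3 * (1 + r) * Δ := by ring
  have hsplit : s₁ * ((Real.exp t + h t) * (Real.exp (s₁ * t) + h (s₁ * t))) -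
      s₂ * ((Real.exp t + h t) * (Real.exp (s₂ * t) + h (s₂ * t))) =
      (Real.exp t + h t) * (s₁ * (Real.exp (s₁ * t) + h (s₁ * t)) - s₂ * (Real.exp (s₂ * t) + h (s₂ * t))) := by
    ring
  rw [hsplit, abs_mul]
  calc |Real.exp t + h t| * |s₁ * (Real.exp (s₁ * t) + h (s₁ * t)) - s₂ * (Real.exp (s₂ * t) + h (s₂ * t))|
      ≤ (1 + r) * Real.exp (t / 2) * (3 * (1 + r) * Δ) := mul_le_mul hb1 hbr (abs_nonneg _) (by positivity)
    _ = 3 * (1 + r) ^ 2 * Δ * Real.exp (t / 2) := by ring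

/-! ## Assembly -/

/-- **THE FORCING IS LIPSCHITZ IN THE TIME RATIO AWAY FROM `s = 2`.**  For `3/2 ≤ s₁, s₂ ≤ σ < 2`, a state
`h` with `|h(ξ)| ≤ re^{ξ/2}` (`ξ ≤ 0`), `|h'(ξ)| ≤ re^{ξ/2}` (`ξ < 0`), and `|δ| ≤ r`: for every `t < 0`,
`|N_{s₁}(h,δ)(t) − N_{s₂}(h,δ)(t)| ≤ (6 + 16r + 4r² + 4r²/(2−σ) + 12r(1+r)²)·|s₁ − s₂|·e^{t/2}`,
`N_s` the forcing of `…RelayNonlinearMap`.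
[cite: Tao2016AveragedNS, §1.2 (dyadic model); cell vocabulary (programme R-lac of the census of stmt-21808, continuation in `s`)] -/
theorem forcing_lipschitz_s {s₁ s₂ σ r : ℝ} (h₁ : 3 / 2 ≤ s₁) (h₁' : s₁ ≤ σ) (h₂ : 3 / 2 ≤ s₂)
    (h₂' : s₂ ≤ σ) (hσ : σ < 2) {h h' : ℝ → ℝ} {δ : ℝ}
    (hd : ∀ ξ : ℝ, ξ < 0 → HasDerivAt h (h' ξ) ξ)
    (hρ : ∀ ξ : ℝ, ξ ≤ 0 → |h ξ| ≤ r * Real.exp (ξ / 2))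
    (hD : ∀ ξ : ℝ, ξ < 0 → |h' ξ| ≤ r * Real.exp (ξ / 2)) (hδ : |δ| ≤ r) {t : ℝ} (ht : t < 0) :
    |((-(Real.exp t - 4 / s₁ ^ 2 * Real.exp (2 * t / s₁)) -
        (2 * Real.exp (t / 2) * h (t / 2) - 8 / s₁ ^ 2 * Real.exp (t / s₁) * h (t / s₁)) +
        4 / s₁ ^ 2 * h (t / s₁) ^ 2 -
        δ * (4 * s₁ * ((Real.exp t + h t) * (Real.exp (s₁ * t) + h (s₁ * t))) - 8 * Real.exp (3 * t)))) -
      ((-(Real.exp t - 4 / s₂ ^ 2 * Real.exp (2 * t / s₂)) -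
        (2 * Real.exp (t / 2) * h (t / 2) - 8 / s₂ ^ 2 * Real.exp (t / s₂) * h (t / s₂)) +
        4 / s₂ ^ 2 * h (t / s₂) ^ 2 -
        δ * (4 * s₂ * ((Real.exp t + h t) * (Real.exp (s₂ * t) + h (s₂ * t))) - 8 * Real.exp (3 * t))))| ≤
      (6 + 16 * r + 4 * r ^ 2 + 4 * r ^ 2 * (1 / (2 - σ)) + 12 * r * (1 + r) ^ 2) * |s₁ - s₂| *
        Real.exp (t / 2) := by
  have hσ2 : σ ≤ 2 := hσ.le
  have hr0 : 0 ≤ r := (abs_nonneg _).trans hδ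
  have e2 : 0 < Real.exp (t / 2) := Real.exp_pos _
  have hΔ0 : 0 ≤ |s₁ - s₂| := abs_nonneg _
  have hT1 := residual_lipschitz_s h₁ (h₁'.trans hσ2) h₂ (h₂'.trans hσ2) ht
  have hT2 := linear_lipschitz_s h₁ (h₁'.trans hσ2) h₂ (h₂'.trans hσ2) hd hρ hD ht
  have hT3 := quadratic_lipschitz_s h₁ h₁' h₂ h₂' hσ hd hρ hD ht
  have hT4 := drain_lipschitz_s h₁ h₂ (h₂'.trans hσ2) hd hρ hD ht
  -- regroup
  have halg : ((-(Real.exp t - 4 / s₁ ^ 2 * Real.exp (2 * t / s₁)) -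
        (2 * Real.exp (t / 2) * h (t / 2) - 8 / s₁ ^ 2 * Real.exp (t / s₁) * h (t / s₁)) +
        4 / s₁ ^ 2 * h (t / s₁) ^ 2 -
        δ * (4 * s₁ * ((Real.exp t + h t) * (Real.exp (s₁ * t) + h (s₁ * t))) - 8 * Real.exp (3 * t)))) -
      ((-(Real.exp t - 4 / s₂ ^ 2 * Real.exp (2 * t / s₂)) -
        (2 * Real.exp (t / 2) * h (t / 2) - 8 / s₂ ^ 2 * Real.exp (t / s₂) * h (t / s₂)) +
        4 / s₂ ^ 2 * h (t / s₂) ^ 2 -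
        δ * (4 * s₂ * ((Real.exp t + h t) * (Real.exp (s₂ * t) + h (s₂ * t))) - 8 * Real.exp (3 * t)))) =
      (4 / s₁ ^ 2 * Real.exp (2 * t / s₁) - 4 / s₂ ^ 2 * Real.exp (2 * t / s₂)) +
      (8 / s₁ ^ 2 * Real.exp (t / s₁) * h (t / s₁) - 8 / s₂ ^ 2 * Real.exp (t / s₂) * h (t / s₂)) +
      (4 / s₁ ^ 2 * h (t / s₁) ^ 2 - 4 / s₂ ^ 2 * h (t / s₂) ^ 2) -
      4 * δ * (s₁ * ((Real.exp t + h t) * (Real.exp (s₁ * t) + h (s₁ * t))) -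
        s₂ * ((Real.exp t + h t) * (Real.exp (s₂ * t) + h (s₂ * t)))) := by ring
  rw [halg]
  have hT4' : |4 * δ * (s₁ * ((Real.exp t + h t) * (Real.exp (s₁ * t) + h (s₁ * t))) -
      s₂ * ((Real.exp t + h t) * (Real.exp (s₂ * t) + h (s₂ * t))))| ≤
      12 * r * (1 + r) ^ 2 * |s₁ - s₂| * Real.exp (t / 2) := by
    rw [abs_mul, abs_mul, abs_of_pos (by norm_num : (0 : ℝ) < 4)]
    calc 4 * |δ| * |s₁ * ((Real.exp t + h t) * (Real.exp (s₁ * t) + h (s₁ * t))) -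
          s₂ * ((Real.exp t + h t) * (Real.exp (s₂ * t) + h (s₂ * t)))|
        ≤ 4 * r * (3 * (1 + r) ^ 2 * |s₁ - s₂| * Real.exp (t / 2)) :=
          mul_le_mul (mul_le_mul_of_nonneg_left hδ (by norm_num)) hT4 (abs_nonneg _) (by positivity)
      _ = 12 * r * (1 + r) ^ 2 * |s₁ - s₂| * Real.exp (t / 2) := by ring
  set A := 4 / s₁ ^ 2 * Real.exp (2 * t / s₁) - 4 / s₂ ^ 2 * Real.exp (2 * t / s₂) with hA
  set Bt := 8 / s₁ ^ 2 * Real.exp (t / s₁) * h (t / s₁) - 8 / s₂ ^ 2 * Real.exp (t / s₂) * h (t / s₂) with hBt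
  set C := 4 / s₁ ^ 2 * h (t / s₁) ^ 2 - 4 / s₂ ^ 2 * h (t / s₂) ^ 2 with hC
  set D := 4 * δ * (s₁ * ((Real.exp t + h t) * (Real.exp (s₁ * t) + h (s₁ * t))) -
        s₂ * ((Real.exp t + h t) * (Real.exp (s₂ * t) + h (s₂ * t)))) with hDdef
  calc |A + Bt + C - D| ≤ |A + Bt + C| + |D| := abs_sub _ _
    _ ≤ |A| + |Bt| + |C| + |D| := by linarith [abs_add_le (A + Bt) C, abs_add_le A Bt]
    _ ≤ 6 * |s₁ - s₂| * Real.exp (t / 2) + 16 * r * |s₁ - s₂| * Real.exp (t / 2) +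
        (4 * r ^ 2 + 4 * r ^ 2 * (1 / (2 - σ))) * |s₁ - s₂| * Real.exp (t / 2) +
        12 * r * (1 + r) ^ 2 * |s₁ - s₂| * Real.exp (t / 2) :=
          add_le_add (add_le_add (add_le_add hT1 hT2) hT3) hT4'
    _ = _ := by ring

end WakeRatchetRelayDilationLipschitz

end Summit.NavierStokesRegularity.NavierStokesRegularity.Theorems

end
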